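import Summits.Ventures.PercRepro.C041TreeZone

/-!
# ROW C-041 — the states of a tree zone and the recursion §15 (c) PROVED (mine-3, gen 57; C-041.md §15 (c), (i))

A STATE of a rooted marked tree zone colours every mark of the root (`true` = red), every edge to a child
(`true` = red, `false` = blue) and, recursively, the child subtrees. The anchor's sub-zone is the blue component
of the root; the red reach `K` is the root together with the red reaches of the children attached by red edges.
A state is ADMISSIBLE when no sub-zone carries both a blue 1-mark and a blue 2-mark; the anchor's sub-zone is
ALL RED / of TYPE 1 / of TYPE 2 according to its blue marks; a state is INVALID when no vertex of `K` carries a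
red mark. This file defines the state space (`TZ.St`), the four predicates, the counts `F`, `T₁`, `T₂`, `I`, `N`, `A = F + T₁`,
`B = F + T₂` as cardinalities, the two counting lemmas (`card_filter_node`: a product of components;
`card_filter_bool`: the split by the colour of a child edge), and proves the recursions of C-041.md §15 (c) for
`F` (`TZ.cF_node`), `A` (`TZ.cA_node`) and `B` (`TZ.cB_node`); the invalid count `I` and the dictionary
`TZ.counts_eq` are in C041TreeStatesInvalid.
-/

namespace PercRepro

namespace TreeClosure

open Finset

/-- The states of a tree zone: the root's 1-marks and 2-marks, and for every child the colour of its edge with a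
state of the child (`true` = red). -/
def TZ.St : TZ → Type
  | .node p q d cs => (Fin p → Bool) × (Fin q → Bool) × ((j : Fin d) → Bool × TZ.St (cs j))

/-- The state space is finite. -/
@[reducible] def TZ.stFintype : (t : TZ) → Fintype t.St
  | .node p q d cs =>
    haveI : ∀ j, Fintype (cs j).St := fun j => TZ.stFintype (cs j)
    inferInstanceAs (Fintype ((Fin p → Bool) × (Fin q → Bool) × ((j : Fin d) → Bool × TZ.St (cs j))))

/-- The finiteness instance of the state space. -/
instance (t : TZ) : Fintype t.St := TZ.stFintype t

/-- The anchor's sub-zone carries a blue 1-mark. -/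
def TZ.rb1 : (t : TZ) → t.St → Prop
  | .node _ _ _ cs, s => (∃ i, s.1 i = false) ∨ ∃ j, (s.2.2 j).1 = false ∧ TZ.rb1 (cs j) (s.2.2 j).2

/-- The anchor's sub-zone carries a blue 2-mark. -/
def TZ.rb2 : (t : TZ) → t.St → Prop
  | .node _ _ _ cs, s => (∃ i, s.2.1 i = false) ∨ ∃ j, (s.2.2 j).1 = false ∧ TZ.rb2 (cs j) (s.2.2 j).2

/-- Every sub-zone other than the anchor's is admissible (a child attached by a red edge must be admissible as a
whole, a merged child only beyond its root sub-zone). -/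
def TZ.admR : (t : TZ) → t.St → Prop
  | .node _ _ _ cs, s => ∀ j,
      ((s.2.2 j).1 = true → TZ.admR (cs j) (s.2.2 j).2 ∧ ¬ (TZ.rb1 (cs j) (s.2.2 j).2 ∧ TZ.rb2 (cs j) (s.2.2 j).2)) ∧
      ((s.2.2 j).1 = false → TZ.admR (cs j) (s.2.2 j).2)

/-- Admissible: every sub-zone, the anchor's included, avoids blue marks of both types. -/
def TZ.adm (t : TZ) (s : t.St) : Prop := t.admR s ∧ ¬ (t.rb1 s ∧ t.rb2 s)

/-- Some vertex of the red reach of the anchor carries a red mark (the state is VALID). -/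
def TZ.redK : (t : TZ) → t.St → Prop
  | .node _ _ _ cs, s => (∃ i, s.1 i = true) ∨ (∃ i, s.2.1 i = true) ∨
      ∃ j, (s.2.2 j).1 = true ∧ TZ.redK (cs j) (s.2.2 j).2

/-- `rb1` is decidable. -/
@[reducible] def TZ.rb1Dec : (t : TZ) → DecidablePred (TZ.rb1 t)
  | .node p q d cs => fun s => by
    haveI : ∀ j, DecidablePred (TZ.rb1 (cs j)) := fun j => TZ.rb1Dec (cs j)
    unfold TZ.rb1
    infer_instance

/-- `rb2` is decidable. -/
@[reducible] def TZ.rb2Dec : (t : TZ) → DecidablePred (TZ.rb2 t)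
  | .node p q d cs => fun s => by
    haveI : ∀ j, DecidablePred (TZ.rb2 (cs j)) := fun j => TZ.rb2Dec (cs j)
    unfold TZ.rb2
    infer_instance

/-- Decidability of `rb1`. -/
instance (t : TZ) : DecidablePred (TZ.rb1 t) := TZ.rb1Dec t
/-- Decidability of `rb2`. -/
instance (t : TZ) : DecidablePred (TZ.rb2 t) := TZ.rb2Dec t

/-- `admR` is decidable. -/
@[reducible] def TZ.admRDec : (t : TZ) → DecidablePred (TZ.admR t)
  | .node p q d cs => fun s => by
    haveI : ∀ j, DecidablePred (TZ.admR (cs j)) := fun j => TZ.admRDec (cs j)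
    unfold TZ.admR
    infer_instance

/-- Decidability of `admR`. -/
instance (t : TZ) : DecidablePred (TZ.admR t) := TZ.admRDec t
/-- Decidability of `adm`. -/
instance (t : TZ) : DecidablePred (TZ.adm t) := fun s => by unfold TZ.adm; infer_instance

/-- `redK` is decidable. -/
@[reducible] def TZ.redKDec : (t : TZ) → DecidablePred (TZ.redK t)
  | .node p q d cs => fun s => by
    haveI : ∀ j, DecidablePred (TZ.redK (cs j)) := fun j => TZ.redKDec (cs j)
    unfold TZ.redK
    infer_instance

/-- Decidability of `redK`. -/
instance (t : TZ) : DecidablePred (TZ.redK t) := TZ.redKDec t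

/-- `F`: admissible states with the anchor's sub-zone all red. -/
noncomputable def TZ.cF (t : TZ) : ℕ := (univ.filter fun s : t.St => t.adm s ∧ ¬ t.rb1 s ∧ ¬ t.rb2 s).card
/-- `T₁`: admissible states of type 1. -/
noncomputable def TZ.cT1 (t : TZ) : ℕ := (univ.filter fun s : t.St => t.adm s ∧ t.rb1 s ∧ ¬ t.rb2 s).card
/-- `T₂`: admissible states of type 2. -/
noncomputable def TZ.cT2 (t : TZ) : ℕ := (univ.filter fun s : t.St => t.adm s ∧ ¬ t.rb1 s ∧ t.rb2 s).card
/-- `I`: admissible invalid states. -/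
noncomputable def TZ.cI (t : TZ) : ℕ := (univ.filter fun s : t.St => t.adm s ∧ ¬ t.redK s).card
/-- `N`: all admissible states. -/
noncomputable def TZ.cN (t : TZ) : ℕ := (univ.filter fun s : t.St => t.adm s).card

/-- A filtered product of three components counts as the product of the filtered components. -/
theorem card_filter_prod3 {α β : Type*} {d : ℕ} {γ : Fin d → Type*} [Fintype α] [Fintype β]
    [∀ j, Fintype (γ j)] (A : α → Prop) (B : β → Prop) (C : ∀ j, γ j → Prop)
    [DecidablePred A] [DecidablePred B] [∀ j, DecidablePred (C j)] :
    (univ.filter fun s : α × β × (∀ j, γ j) => A s.1 ∧ B s.2.1 ∧ ∀ j, C j (s.2.2 j)).card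
      = (univ.filter A).card * (univ.filter B).card * ∏ j, (univ.filter (C j)).card := by
  classical
  rw [← Fintype.card_subtype, ← Fintype.card_subtype, ← Fintype.card_subtype]
  simp_rw [← Fintype.card_subtype]
  rw [Fintype.card_congr (Equiv.subtypeProdEquivProd (p := A)
    (q := fun x : β × (∀ j, γ j) => B x.1 ∧ ∀ j, C j (x.2 j))), Fintype.card_prod,
    Fintype.card_congr (Equiv.subtypeProdEquivProd (p := B) (q := fun f : ∀ j, γ j => ∀ j, C j (f j))),
    Fintype.card_prod, Fintype.card_congr (Equiv.subtypePiEquivPi (p := C)), Fintype.card_pi, mul_assoc]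

/-- The same on the states of a node. -/
theorem card_filter_node (p q d : ℕ) (cs : Fin d → TZ) (A : (Fin p → Bool) → Prop)
    (B : (Fin q → Bool) → Prop) (C : ∀ j, Bool × (cs j).St → Prop)
    [DecidablePred A] [DecidablePred B] [∀ j, DecidablePred (C j)] :
    (univ.filter fun s : (TZ.node p q d cs).St => A s.1 ∧ B s.2.1 ∧ ∀ j, C j (s.2.2 j)).card
      = (univ.filter A).card * (univ.filter B).card * ∏ j, (univ.filter (C j)).card :=
  card_filter_prod3 A B C

/-- The colourings of one child edge with a child state, split by the colour of the edge. -/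
theorem card_filter_bool {γ : Type*} [Fintype γ] (R B : γ → Prop) [DecidablePred R] [DecidablePred B] :
    (univ.filter fun x : Bool × γ => (x.1 = true → R x.2) ∧ (x.1 = false → B x.2)).card
      = (univ.filter R).card + (univ.filter B).card := by
  classical
  rw [Finset.card_filter, Fintype.sum_prod_type, Fintype.sum_bool]
  simp only [Bool.false_eq_true, Bool.true_eq_false, IsEmpty.forall_iff, true_and, and_true,
    forall_const, Finset.sum_boole, Nat.cast_id]

/-- The number of all-red colourings of `n` marks is one. -/
theorem card_allRed (n : ℕ) : (univ.filter fun m : Fin n → Bool => ∀ i, m i = true).card = 1 := by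
  rw [Finset.card_eq_one]
  exact ⟨fun _ => true, by ext m; simp [funext_iff]⟩

/-- The states with the anchor's sub-zone all red, on a node. -/
theorem TZ.predF_node (p q d : ℕ) (cs : Fin d → TZ) (s : (TZ.node p q d cs).St) :
    ((TZ.node p q d cs).adm s ∧ ¬ (TZ.node p q d cs).rb1 s ∧ ¬ (TZ.node p q d cs).rb2 s)
      ↔ ((∀ i, s.1 i = true) ∧ (∀ i, s.2.1 i = true) ∧
          ∀ j, ((s.2.2 j).1 = true → (cs j).adm (s.2.2 j).2) ∧
            ((s.2.2 j).1 = false → (cs j).adm (s.2.2 j).2 ∧ ¬ (cs j).rb1 (s.2.2 j).2 ∧ ¬ (cs j).rb2 (s.2.2 j).2)) := by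
  simp only [TZ.adm, TZ.rb1, TZ.rb2, TZ.admR, not_or, not_exists, not_and, Bool.not_eq_false]
  constructor
  · rintro ⟨⟨hadm, -⟩, ⟨h1, h1'⟩, ⟨h2, h2'⟩⟩
    refine ⟨h1, h2, fun j => ⟨fun he => (hadm j).1 he, fun he => ?_⟩⟩
    exact ⟨⟨(hadm j).2 he, fun ha _ => h1' j he ha⟩, h1' j he, h2' j he⟩
  · rintro ⟨h1, h2, h⟩
    have hn1 : (∀ i, s.1 i = true) ∧ ∀ j, (s.2.2 j).1 = false → ¬ (cs j).rb1 (s.2.2 j).2 :=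
      ⟨h1, fun j he => ((h j).2 he).2.1⟩
    have hn2 : (∀ i, s.2.1 i = true) ∧ ∀ j, (s.2.2 j).1 = false → ¬ (cs j).rb2 (s.2.2 j).2 :=
      ⟨h2, fun j he => ((h j).2 he).2.2⟩
    exact ⟨⟨fun j => ⟨fun he => (h j).1 he, fun he => ((h j).2 he).1.1⟩, fun _ => hn2⟩, hn1, hn2⟩

/-- **The recursion for `F`** (C-041.md §15 (c)): `F = ∏ (F_j + N_j)`. -/
theorem TZ.cF_node (p q d : ℕ) (cs : Fin d → TZ) :
    (TZ.node p q d cs).cF = ∏ j, ((cs j).cF + (cs j).cN) := by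
  unfold TZ.cF
  rw [Finset.filter_congr (fun s _ => TZ.predF_node p q d cs s)]
  rw [card_filter_node p q d cs (fun m => ∀ i, m i = true) (fun m => ∀ i, m i = true)
    (fun j x => (x.1 = true → (cs j).adm x.2) ∧
      (x.1 = false → (cs j).adm x.2 ∧ ¬ (cs j).rb1 x.2 ∧ ¬ (cs j).rb2 x.2))]
  rw [card_allRed, card_allRed, one_mul, one_mul]
  refine Finset.prod_congr rfl (fun j _ => ?_)
  unfold TZ.cN
  rw [add_comm]
  exact card_filter_bool (cs j).adm (fun x => (cs j).adm x ∧ ¬ (cs j).rb1 x ∧ ¬ (cs j).rb2 x)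

/-- `A`: admissible states whose anchor sub-zone has all its 2-marks red (`F + T₁`). -/
noncomputable def TZ.cA (t : TZ) : ℕ := (univ.filter fun s : t.St => t.adm s ∧ ¬ t.rb2 s).card
/-- `B`: admissible states whose anchor sub-zone has all its 1-marks red (`F + T₂`). -/
noncomputable def TZ.cB (t : TZ) : ℕ := (univ.filter fun s : t.St => t.adm s ∧ ¬ t.rb1 s).card

/-- `A = F + T₁`. -/
theorem TZ.cA_eq (t : TZ) : t.cA = t.cF + t.cT1 := by
  unfold TZ.cA TZ.cF TZ.cT1
  rw [← Finset.card_filter_add_card_filter_not (fun s => ¬ t.rb1 s)]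
  simp only [Finset.filter_filter, not_not]
  congr 2 <;> ext s <;> simp only [Finset.mem_filter, Finset.mem_univ, true_and] <;> tauto

/-- `B = F + T₂`. -/
theorem TZ.cB_eq (t : TZ) : t.cB = t.cF + t.cT2 := by
  unfold TZ.cB TZ.cF TZ.cT2
  rw [← Finset.card_filter_add_card_filter_not (fun s => ¬ t.rb2 s)]
  simp only [Finset.filter_filter, not_not]
  congr 2 <;> ext s <;> simp only [Finset.mem_filter, Finset.mem_univ, true_and] <;> tauto

/-- `N = F + T₁ + T₂` (an admissible state is not of both types). -/
theorem TZ.cN_eq (t : TZ) : t.cN = t.cF + t.cT1 + t.cT2 := by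
  rw [← TZ.cA_eq]
  unfold TZ.cN TZ.cA TZ.cT2
  rw [← Finset.card_filter_add_card_filter_not (fun s => ¬ t.rb2 s)]
  simp only [Finset.filter_filter, not_not]
  congr 2
  ext s
  simp only [Finset.mem_filter, Finset.mem_univ, true_and, TZ.adm]
  tauto

/-- The number of colourings of `n` marks is `2^n`. -/
theorem card_allMarks (n : ℕ) : (univ.filter fun _ : Fin n → Bool => True).card = 2 ^ n := by
  rw [Finset.filter_true_of_mem (fun _ _ => trivial), Finset.card_univ, Fintype.card_fun, Fintype.card_bool,
    Fintype.card_fin]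

/-- The states whose anchor sub-zone has its 2-marks all red, on a node. -/
theorem TZ.predA_node (p q d : ℕ) (cs : Fin d → TZ) (s : (TZ.node p q d cs).St) :
    ((TZ.node p q d cs).adm s ∧ ¬ (TZ.node p q d cs).rb2 s)
      ↔ (True ∧ (∀ i, s.2.1 i = true) ∧
          ∀ j, ((s.2.2 j).1 = true → (cs j).adm (s.2.2 j).2) ∧
            ((s.2.2 j).1 = false → (cs j).adm (s.2.2 j).2 ∧ ¬ (cs j).rb2 (s.2.2 j).2)) := by
  simp only [TZ.adm, TZ.rb1, TZ.rb2, TZ.admR, not_or, not_exists, not_and, Bool.not_eq_false, true_and]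
  constructor
  · rintro ⟨⟨hadm, -⟩, ⟨h2, h2'⟩⟩
    refine ⟨h2, fun j => ⟨fun he => (hadm j).1 he, fun he => ?_⟩⟩
    exact ⟨⟨(hadm j).2 he, fun _ hb => h2' j he hb⟩, h2' j he⟩
  · rintro ⟨h2, h⟩
    have hn2 : (∀ i, s.2.1 i = true) ∧ ∀ j, (s.2.2 j).1 = false → ¬ (cs j).rb2 (s.2.2 j).2 :=
      ⟨h2, fun j he => ((h j).2 he).2⟩
    exact ⟨⟨fun j => ⟨fun he => (h j).1 he, fun he => ((h j).2 he).1.1⟩, fun _ => hn2⟩, hn2⟩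

/-- The states whose anchor sub-zone has its 1-marks all red, on a node. -/
theorem TZ.predB_node (p q d : ℕ) (cs : Fin d → TZ) (s : (TZ.node p q d cs).St) :
    ((TZ.node p q d cs).adm s ∧ ¬ (TZ.node p q d cs).rb1 s)
      ↔ ((∀ i, s.1 i = true) ∧ True ∧
          ∀ j, ((s.2.2 j).1 = true → (cs j).adm (s.2.2 j).2) ∧
            ((s.2.2 j).1 = false → (cs j).adm (s.2.2 j).2 ∧ ¬ (cs j).rb1 (s.2.2 j).2)) := by
  simp only [TZ.adm, TZ.rb1, TZ.rb2, TZ.admR, not_or, not_exists, not_and, Bool.not_eq_false, true_and]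
  constructor
  · rintro ⟨⟨hadm, -⟩, ⟨h1, h1'⟩⟩
    refine ⟨h1, fun j => ⟨fun he => (hadm j).1 he, fun he => ?_⟩⟩
    exact ⟨⟨(hadm j).2 he, fun ha _ => h1' j he ha⟩, h1' j he⟩
  · rintro ⟨h1, h⟩
    have hn1 : (∀ i, s.1 i = true) ∧ ∀ j, (s.2.2 j).1 = false → ¬ (cs j).rb1 (s.2.2 j).2 :=
      ⟨h1, fun j he => ((h j).2 he).2⟩
    have hnr : ¬ ((∃ i, s.1 i = false) ∨ ∃ j, (s.2.2 j).1 = false ∧ (cs j).rb1 (s.2.2 j).2) := by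
      rintro (⟨i, hi⟩ | ⟨j, hje, hj⟩)
      · exact absurd (hn1.1 i) (by simp [hi])
      · exact hn1.2 j hje hj
    exact ⟨⟨fun j => ⟨fun he => (h j).1 he, fun he => ((h j).2 he).1.1⟩, fun ha => (hnr ha).elim⟩, hn1⟩

/-- **The recursion for `A = F + T₁`**: `A = 2^p ∏ (A_j + N_j)`. -/
theorem TZ.cA_node (p q d : ℕ) (cs : Fin d → TZ) :
    (TZ.node p q d cs).cA = 2 ^ p * ∏ j, ((cs j).cA + (cs j).cN) := by
  unfold TZ.cA
  rw [Finset.filter_congr (fun s _ => TZ.predA_node p q d cs s)]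
  rw [card_filter_node p q d cs (fun _ => True) (fun m => ∀ i, m i = true)
    (fun j x => (x.1 = true → (cs j).adm x.2) ∧ (x.1 = false → (cs j).adm x.2 ∧ ¬ (cs j).rb2 x.2))]
  rw [card_allMarks, card_allRed, mul_one]
  congr 1
  refine Finset.prod_congr rfl (fun j _ => ?_)
  unfold TZ.cN
  rw [add_comm]
  exact card_filter_bool (cs j).adm (fun x => (cs j).adm x ∧ ¬ (cs j).rb2 x)

/-- **The recursion for `B = F + T₂`**: `B = 2^q ∏ (B_j + N_j)`. -/
theorem TZ.cB_node (p q d : ℕ) (cs : Fin d → TZ) :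
    (TZ.node p q d cs).cB = 2 ^ q * ∏ j, ((cs j).cB + (cs j).cN) := by
  unfold TZ.cB
  rw [Finset.filter_congr (fun s _ => TZ.predB_node p q d cs s)]
  rw [card_filter_node p q d cs (fun m => ∀ i, m i = true) (fun _ => True)
    (fun j x => (x.1 = true → (cs j).adm x.2) ∧ (x.1 = false → (cs j).adm x.2 ∧ ¬ (cs j).rb1 x.2))]
  rw [card_allMarks, card_allRed, one_mul]
  congr 1
  refine Finset.prod_congr rfl (fun j _ => ?_)
  unfold TZ.cN
  rw [add_comm]
  exact card_filter_bool (cs j).adm (fun x => (cs j).adm x ∧ ¬ (cs j).rb1 x)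

end TreeClosure

end PercRepro
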